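import Literature.RepresentationTheory.KonnoKonno2007.JunctionHyperbolicFockMatrix
import Literature.Analysis.SegalBargmann.SchwartzDegreeOneKTypes
import HarnessLib

/-!
# The second boost of a hyperbolic plane and the Fock symbol of `𝔭⁻`
  [cite: Folland1989, Prop (4.39)]

REPRODUCTION (Literature side; folklore Fock-model algebra over the tree's Schrödinger model of a real unitary
dual pair `(U(P,Q), U(R,S))`, `Literature.RepresentationTheory.KonnoKonno2007.RealDualPair`).

The hyperbolic family `hyp t = (hypV p₀ q₀ t, 1)` of `JunctionHyperbolicFamily` is the boost `exp(t X_v)`,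
`X_v = [[0, v],[v̄ᵀ, 0]]`, in the direction `v = −i e_{p₀}` of `𝔭 ≅ Hom(V⁻_{q₀}, V⁺)`.  Its partner in the direction
`e^{iθ} v` is the conjugate of `hyp t` by the PHASE ELEMENT `k_P(θ) = (e^{iθ} at p₀) ∈ U(P) ⊂ K` (§2), and the complex
structure of `𝔭` is `θ = π/2`.  In the Schrödinger model `𝓢(ℝ^{DPIdx})` the conjugated family is
`rotBoostOp θ t = μ₀(ι k_P(θ)) ∘ hypOp t ∘ μ₀(ι k_P(θ))⁻¹` (§3) with generator `rotBoostGen θ`; its FOCK MATRIX (§4) is read off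
from theta-1's `hypOpGen_binvPi_frame` and the diagonal substitution calculus of §1: per hyperbolic plane the pair
symbol `π z z' + π⁻¹ ∂∂'` is re-weighted by the phases `e^{±iθ}`.  MAIN IDENTITY (§5):

  `hypOpGen (B⁻¹F) + i · rotBoostGen (π/2) (B⁻¹F) = B⁻¹ ( 2πi Σ_{s∈S} z_{(p₀,s)} z_{(q₀,s)} F − (2i/π) Σ_{r∈R} ∂_{(p₀,r)} ∂_{(q₀,r)} F )`

— the element `X_v + i X_{iv} = 2 v̄ᵀ ∈ 𝔭⁻` (LOWER-LEFT block) acts by ANNIHILATION on the `R`-planes and by CREATION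
on the `S`-planes; the conjugate combination `X_v − i X_{iv} ∈ 𝔭⁺` the other way round (`…_sub_…`).  Hence for
`S = ∅` (the second member `U(R,S)` compact, `W` positive definite) `𝔭⁻` kills every `B⁻¹F` with `∂_{(p₀,r)}∂_{(q₀,r)}F = 0`:
the vacuum, all degree-one vectors, every polynomial in the `P × R` variables (§5).  The transport to a genuine
archimedean Weil datum `ω` (`ω` of the conjugated boost `κ k_P(θ) · (hypV t, 1) · κ k_P(θ)⁻¹` IS `rotBoostOp θ t`, slopes,
annihilation) is the sequel `JunctionPMinusWeilDatum`.

Sources: G. B. Folland, *Harmonic Analysis in Phase Space* (1989), Prop. (4.39), (4.24), §1.7 (the infinitesimal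
Fock model: `sp` acts by the Weyl-symmetrised quadratic operators; `z z'` / `∂∂'` are the `𝔭^±` parts);
M. Kashiwara, M. Vergne, *On the Segal–Shale–Weil representations and harmonic polynomials*, Invent. Math. 44 (1978),
§5 (pluriharmonics = vectors killed by the `∂∂'` operators); confirmatory: J. Adams, *The theta correspondence over ℝ*
(2007) Thm 6.1; K. Konno, T. Konno, Tokyo J. Math. 30 (2007) §3.1.

## Provenance

LEAN-IN-TREE rule (2026-08-18), pub-hodgecm formalisation cell, model-construction sub-cell, seat mc-theta-2 gen 5,
node «W6b-hol (REP)» (RULING (YY′) 2026-08-19).  Over theta-1's `JunctionHyperbolicFockMatrix` and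
`SchwartzDegreeOneKTypes`.  Kernel only, no records.
-/

set_option autoImplicit false

noncomputable section

open Matrix Complex MeasureTheory Filter MvPolynomial
open scoped Topology Real BigOperators ComplexConjugate
open Literature.Analysis.SegalBargmann Literature.Analysis.Distribution

local notation "SR" σ => SchwartzMap (σ → ℝ) ℂ

namespace Literature.Analysis.SegalBargmann

/-! ## §1  Weighted pair symbols and the diagonal substitution calculus (generic) -/

section Diagonal

variable {σ : Type*} [Fintype σ] [DecidableEq σ]

omit [Fintype σ] [DecidableEq σ] in
/-- the WEIGHTED PAIR SYMBOL of a hyperbolic plane `{k, k'}`: `pairSymbW a b k k' F = a • z_k z_{k'} F + b • ∂_k ∂_{k'} F`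
(`hypPairSymb = pairSymbW π π⁻¹`). [folklore] -/
def pairSymbW (a b : ℂ) (k k' : σ) (F : MvPolynomial σ ℂ) : MvPolynomial σ ℂ :=
  a • (X k * (X k' * F)) + b • pderiv k (pderiv k' F)

/-- `linSubst (diagonal d) z_k = d_k z_k`. [folklore] -/
theorem linSubst_diagonal_X (d : σ → ℂ) (k : σ) :
    linSubst (Matrix.diagonal d) (X k : MvPolynomial σ ℂ) = C (d k) * X k := by
  rw [linSubst_X, Finset.sum_eq_single k (fun j _ hj => by
    rw [Matrix.diagonal_apply_ne _ (Ne.symm hj), map_zero, zero_mul]) (fun h => absurd (Finset.mem_univ k) h),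
    Matrix.diagonal_apply_eq]

/-- `linSubst (diagonal d) (z_k G) = d_k • z_k linSubst (diagonal d) G`. [folklore] -/
theorem linSubst_diagonal_X_mul (d : σ → ℂ) (k : σ) (G : MvPolynomial σ ℂ) :
    linSubst (Matrix.diagonal d) (X k * G) = d k • (X k * linSubst (Matrix.diagonal d) G) := by
  rw [map_mul, linSubst_diagonal_X, mul_assoc, MvPolynomial.C_mul']

/-- `∂_m (F ∘ diagonal d) = d_m • (∂_m F) ∘ diagonal d`. [folklore] -/
theorem pderiv_linSubst_diagonal (d : σ → ℂ) (m : σ) (F : MvPolynomial σ ℂ) :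
    pderiv m (linSubst (Matrix.diagonal d) F) = d m • linSubst (Matrix.diagonal d) (pderiv m F) := by
  rw [pderiv_linSubst, Finset.sum_eq_single m (fun i _ hi => by
    rw [Matrix.diagonal_apply_ne _ hi, zero_smul]) (fun h => absurd (Finset.mem_univ m) h),
    Matrix.diagonal_apply_eq]

/-- a unitary diagonal substitution is undone by the conjugate one: `linSubst (diagonal d̄) (linSubst (diagonal d) F) = F`
when `d_l d̄_l = 1`. [folklore] -/
theorem linSubst_diagonal_star_linSubst_diagonal (d : σ → ℂ) (hd : ∀ l, d l * star (d l) = 1)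
    (F : MvPolynomial σ ℂ) :
    linSubst (Matrix.diagonal (star d)) (linSubst (Matrix.diagonal d) F) = F := by
  rw [linSubst_linSubst, Matrix.diagonal_mul_diagonal,
    show (fun l => d l * star d l) = fun _ => (1 : ℂ) from funext fun l => hd l, Matrix.diagonal_one,
    linSubst_one_apply]

/-- **conjugating a weighted pair symbol by a unitary diagonal substitution re-weights it**:
`linSubst (diagonal d̄) (pairSymbW a b k k' (linSubst (diagonal d) F)) = pairSymbW (a d̄_k d̄_{k'}) (b d_k d_{k'}) k k' F`.
[folklore] -/
theorem linSubst_diagonal_star_pairSymbW (d : σ → ℂ) (hd : ∀ l, d l * star (d l) = 1) (a b : ℂ) (k k' : σ)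
    (F : MvPolynomial σ ℂ) :
    linSubst (Matrix.diagonal (star d)) (pairSymbW a b k k' (linSubst (Matrix.diagonal d) F)) =
      pairSymbW (a * (star (d k) * star (d k'))) (b * (d k * d k')) k k' F := by
  have h1 : linSubst (Matrix.diagonal (star d)) (X k * (X k' * linSubst (Matrix.diagonal d) F)) =
      (star (d k) * star (d k')) • (X k * (X k' * F)) := by
    rw [linSubst_diagonal_X_mul, linSubst_diagonal_X_mul, linSubst_diagonal_star_linSubst_diagonal d hd,
      mul_smul_comm, smul_smul, Pi.star_apply, Pi.star_apply]
  have h2 : linSubst (Matrix.diagonal (star d)) (pderiv k (pderiv k' (linSubst (Matrix.diagonal d) F))) =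
      (d k * d k') • pderiv k (pderiv k' F) := by
    rw [pderiv_linSubst_diagonal, Derivation.map_smul, pderiv_linSubst_diagonal, map_smul, map_smul,
      linSubst_diagonal_star_linSubst_diagonal d hd, smul_smul, mul_comm (d k') (d k)]
  rw [pairSymbW, map_add, map_smul, map_smul, h1, h2, smul_smul, smul_smul, pairSymbW]

omit [Fintype σ] in
/-- `∂_k ∂_{k'} z_j = 0`. [folklore] -/
theorem pderiv_pderiv_X (k k' j : σ) : pderiv k (pderiv k' (X j : MvPolynomial σ ℂ)) = 0 := by
  by_cases h : j = k'
  · subst h; rw [pderiv_X_self, ← C_1, pderiv_C]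
  · rw [pderiv_X_of_ne h, map_zero]

/-- `∂_k ∂_{k'} ζ_{e_j} = 0`. [folklore] -/
theorem pderiv_pderiv_zeta_single (k k' j : σ) :
    pderiv k (pderiv k' (zeta (Finsupp.single j 1) : MvPolynomial σ ℂ)) = 0 := by
  rw [zeta_single, Derivation.map_smul, Derivation.map_smul, pderiv_pderiv_X, smul_zero]

omit [DecidableEq σ] in
/-- `∂_{k'} ζ_0 = 0` (the vacuum symbol is a constant). [folklore] -/
theorem pderiv_zeta_zero (k' : σ) : pderiv k' (zeta (0 : σ →₀ ℕ) : MvPolynomial σ ℂ) = 0 := by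
  rw [zeta, Derivation.map_smul, pderiv_monomial, Finsupp.zero_apply, Nat.cast_zero, mul_zero, map_zero, smul_zero]

omit [DecidableEq σ] in
/-- `∂_k ∂_{k'} ζ_0 = 0`. [folklore] -/
theorem pderiv_pderiv_zeta_zero (k k' : σ) :
    pderiv k (pderiv k' (zeta (0 : σ →₀ ℕ) : MvPolynomial σ ℂ)) = 0 := by
  rw [pderiv_zeta_zero, map_zero]

/-- `∂_k ∂_{k'}` of a degree-one combination vanishes. [folklore] -/
theorem pderiv_pderiv_sum_smul_zeta_single (k k' : σ) (s : Finset σ) (c : σ → ℂ) :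
    pderiv k (pderiv k' (∑ j ∈ s, c j • (zeta (Finsupp.single j 1) : MvPolynomial σ ℂ))) = 0 := by
  rw [map_sum, map_sum]
  exact Finset.sum_eq_zero fun j _ => by
    rw [Derivation.map_smul, Derivation.map_smul, pderiv_pderiv_zeta_single, smul_zero]

/-- `B⁻¹ 0 = 0`. [folklore] -/
theorem binvPi_zero : binvPi (0 : MvPolynomial σ ℂ) = (0 : SR σ) := by
  rw [← binvPiₗ_apply, map_zero]

/-- `B⁻¹ (F − G) = B⁻¹F − B⁻¹G`. [folklore] -/
theorem binvPi_sub (F G : MvPolynomial σ ℂ) : binvPi (F - G) = (binvPi F - binvPi G : SR σ) := by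
  rw [← binvPiₗ_apply, map_sub, binvPiₗ_apply, binvPiₗ_apply]

omit [Fintype σ] [DecidableEq σ] in
/-- `star z = z⁻¹` for a point of the unit circle (as complex numbers). [folklore] -/
theorem star_coe_circle (z : Circle) : star ((z : Circle) : ℂ) = (((z : Circle) : ℂ))⁻¹ := by
  rw [Complex.star_def, ← Circle.coe_inv_eq_conj, Circle.coe_inv]

omit [Fintype σ] [DecidableEq σ] in
/-- `z · star z = 1` for a point of the unit circle. [folklore] -/
theorem coe_circle_mul_star (z : Circle) : ((z : Circle) : ℂ) * star ((z : Circle) : ℂ) = 1 := by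
  rw [star_coe_circle, mul_inv_cancel₀ (Circle.coe_ne_zero z)]

omit [Fintype σ] [DecidableEq σ] in
/-- `e^{iπ/2} = i` on the unit circle. [folklore] -/
theorem coe_circleExp_pi_div_two : ((Circle.exp (π / 2) : Circle) : ℂ) = I := by
  rw [Circle.coe_exp, Complex.ofReal_div, Complex.ofReal_ofNat, Complex.exp_mul_I, Complex.cos_pi_div_two,
    Complex.sin_pi_div_two, one_mul, zero_add]

end Diagonal

end Literature.Analysis.SegalBargmann

namespace Literature.RepresentationTheory.KonnoKonno2007

namespace RealDualPair

open Literature.NumberTheory.Weil1964 Literature.NumberTheory.Automorphic Literature.NumberTheory.Automorphic.UnitaryGroup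

/-! ## §2  The phase element `k_P(θ)` and the diagonal of `ι k_P(θ)` -/

section Phase

variable {P Q : Type*} [Fintype P] [DecidableEq P] [Fintype Q] [DecidableEq Q]
  (R S : Type*) [Fintype R] [DecidableEq R] [Fintype S] [DecidableEq S] (p₀ : P) (q₀ : Q)

omit [Fintype P] [Fintype Q] [Fintype R] [Fintype S] [DecidableEq Q] [DecidableEq R] [DecidableEq S] in
/-- `hypPairSymb = pairSymbW π π⁻¹`. [folklore] -/
theorem hypPairSymb_eq_pairSymbW {σ : Type*} (k k' : σ) (F : MvPolynomial σ ℂ) :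
    hypPairSymb k k' F = pairSymbW (π : ℂ) (π : ℂ)⁻¹ k k' F := rfl

/-- **the phase element** `k_P(θ) = ((e^{iθ} at p₀ on ℂ^P, 1), (1, 1)) ∈ (U(P) × U(Q)) × (U(R) × U(S))`: the circle of
the complex structure of `𝔭` through the `p₀`-th coordinate of `V⁺`. [folklore] -/
def phaseP (θ : ℝ) : DPK P Q R S :=
  ((diagHom (circleAt p₀ θ), diagHom 1), (diagHom 1, diagHom 1))

omit [Fintype P] [Fintype Q] [Fintype R] [Fintype S] [DecidableEq P] [DecidableEq Q] [DecidableEq R]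
  [DecidableEq S] in
/-- `diagHom 1 = 1`. [folklore] -/
theorem diagHom_one {τ : Type*} [Fintype τ] [DecidableEq τ] : (diagHom (1 : τ → Circle) : Matrix.unitaryGroup τ ℂ) = 1 :=
  Subtype.ext (by rw [coe_diagHom']; simp only [Pi.one_apply, Circle.coe_one, Matrix.diagonal_one]; rfl)

/-- `k_P(θ)` with the identity factors written as `1`. [folklore] -/
theorem phaseP_eq (θ : ℝ) :
    (phaseP R S p₀ θ : DPK P Q R S) = ((diagHom (circleAt p₀ θ), 1), (1, 1)) := by
  rw [phaseP, diagHom_one, diagHom_one, diagHom_one]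

/-- the diagonal WEIGHT of `ι k_P(θ)` on `DPIdx`: `e^{−iθ}` on the `(p₀, r)`, `e^{iθ}` on the `(p₀, s)`, `1` elsewhere
(as the torus point `dpTorus (circleAt p₀ θ) 1 1 1`). [folklore] -/
def phaseWt (θ : ℝ) : DPIdx P Q R S → ℂ := fun l => ((dpTorus (circleAt p₀ θ) 1 1 1 l : Circle) : ℂ)

/-- **`ι k_P(θ)` is diagonal** with weight `phaseWt θ`. [folklore] -/
theorem coe_dualPairι_phaseP (θ : ℝ) :
    ((dualPairι (phaseP R S p₀ θ : DPK P Q R S) : Matrix.unitaryGroup (DPIdx P Q R S) ℂ) :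
        Matrix (DPIdx P Q R S) (DPIdx P Q R S) ℂ) = Matrix.diagonal (phaseWt R S p₀ θ) := by
  rw [phaseP, dualPairι_diagHom, coe_diagHom']; rfl

omit [Fintype P] [Fintype Q] [Fintype R] [Fintype S] [DecidableEq Q] [DecidableEq R] [DecidableEq S] in
/-- the weight is unitary: `w_l · w̄_l = 1`. [folklore] -/
theorem phaseWt_mul_star (θ : ℝ) (l : DPIdx P Q R S) :
    phaseWt R S p₀ θ l * star (phaseWt R S p₀ θ l) = 1 :=
  coe_circle_mul_star _

omit [Fintype P] [Fintype Q] [Fintype R] [Fintype S] [DecidableEq Q] [DecidableEq R] [DecidableEq S] in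
/-- weight at `(p₀, r) ∈ P × R`: `e^{−iθ} = star e^{iθ}`. [folklore] -/
theorem phaseWt_PR (θ : ℝ) (r : R) :
    phaseWt R S p₀ θ (Sum.inl (Sum.inl (p₀, r)) : DPIdx P Q R S) = star ((Circle.exp θ : Circle) : ℂ) := by
  simp only [phaseWt, dpTorus, Sum.elim_inl, circleAt, Function.update_self, Pi.one_apply, mul_one,
    Circle.coe_inv, star_coe_circle]

omit [Fintype P] [Fintype Q] [Fintype R] [Fintype S] [DecidableEq Q] [DecidableEq R] [DecidableEq S] in
/-- weight at `(q₀, r) ∈ Q × R`: `1`. [folklore] -/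
theorem phaseWt_QR (θ : ℝ) (r : R) : phaseWt R S p₀ θ (Sum.inr (Sum.inr (q₀, r)) : DPIdx P Q R S) = 1 := by
  simp only [phaseWt, dpTorus, Sum.elim_inr, Pi.one_apply, mul_one, Circle.coe_one]

omit [Fintype P] [Fintype Q] [Fintype R] [Fintype S] [DecidableEq Q] [DecidableEq R] [DecidableEq S] in
/-- weight at `(p₀, s) ∈ P × S`: `e^{iθ}`. [folklore] -/
theorem phaseWt_PS (θ : ℝ) (s : S) :
    phaseWt R S p₀ θ (Sum.inr (Sum.inl (p₀, s)) : DPIdx P Q R S) = ((Circle.exp θ : Circle) : ℂ) := by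
  simp only [phaseWt, dpTorus, Sum.elim_inr, Sum.elim_inl, circleAt, Function.update_self, Pi.one_apply, mul_one]

omit [Fintype P] [Fintype Q] [Fintype R] [Fintype S] [DecidableEq Q] [DecidableEq R] [DecidableEq S] in
/-- weight at `(q₀, s) ∈ Q × S`: `1`. [folklore] -/
theorem phaseWt_QS (θ : ℝ) (s : S) : phaseWt R S p₀ θ (Sum.inl (Sum.inr (q₀, s)) : DPIdx P Q R S) = 1 := by
  simp only [phaseWt, dpTorus, Sum.elim_inl, Sum.elim_inr, Pi.one_apply, mul_one, inv_one, Circle.coe_one]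

/-- abbreviation: the unitary `D_θ = ι k_P(θ)` of `ℂ^{DPIdx}`. [folklore] -/
def phaseU (θ : ℝ) : Matrix.unitaryGroup (DPIdx P Q R S) ℂ := dualPairι (phaseP R S p₀ θ : DPK P Q R S)

/-- unfolding `phaseU`. [folklore] -/
theorem phaseU_def (θ : ℝ) : phaseU R S p₀ θ = dualPairι (phaseP R S p₀ θ : DPK P Q R S) := rfl

/-- matrix of `D_θ`. [folklore] -/
theorem coe_phaseU (θ : ℝ) :
    ((phaseU R S p₀ θ : Matrix.unitaryGroup (DPIdx P Q R S) ℂ) : Matrix (DPIdx P Q R S) (DPIdx P Q R S) ℂ) =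
      Matrix.diagonal (phaseWt R S p₀ θ) :=
  coe_dualPairι_phaseP R S p₀ θ

end Phase

/-! ## §3  The conjugated boost family `rotBoostOp θ t` on `𝓢` and its generator -/

section Rot

variable {P Q : Type*} [Fintype P] [DecidableEq P] [Fintype Q] [DecidableEq Q]
  (R S : Type*) [Fintype R] [DecidableEq R] [Fintype S] [DecidableEq S] (p₀ : P) (q₀ : Q)

/-- **the conjugated boost family** `rotBoostOp θ t = μ₀(D_θ) ∘ hypOp t ∘ μ₀(D_θ)⁻¹` on `𝓢(ℝ^{DPIdx})` — the Schrödinger-model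
operators of the boost in the direction `e^{iθ} v` of the hyperbolic plane. [cite: Folland1989, Prop (4.39)] -/
def rotBoostOp (θ t : ℝ) : (SR (DPIdx P Q R S)) →L[ℂ] SR (DPIdx P Q R S) :=
  (unitaryOpPi (phaseU R S p₀ θ)).comp ((hypOp R S p₀ q₀ t).comp (unitaryOpPi (phaseU R S p₀ θ)⁻¹))

/-- unfolding `rotBoostOp`. [folklore] -/
theorem rotBoostOp_apply (θ t : ℝ) (f : SR (DPIdx P Q R S)) :
    rotBoostOp R S p₀ q₀ θ t f = unitaryOpPi (phaseU R S p₀ θ) (hypOp R S p₀ q₀ t (unitaryOpPi (phaseU R S p₀ θ)⁻¹ f)) :=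
  rfl

/-- **the generator** `rotBoostGen θ = μ₀(D_θ) ∘ hypOpGen ∘ μ₀(D_θ)⁻¹` (real scalars, as `hypOpGen`). [cite: Folland1989, (4.24)] -/
def rotBoostGen (θ : ℝ) : (SR (DPIdx P Q R S)) →L[ℝ] SR (DPIdx P Q R S) :=
  ((unitaryOpPi (phaseU R S p₀ θ) : (SR (DPIdx P Q R S)) →L[ℂ] SR (DPIdx P Q R S)).restrictScalars ℝ).comp
    ((hypOpGen R S p₀ q₀).comp
      ((unitaryOpPi (phaseU R S p₀ θ)⁻¹ : (SR (DPIdx P Q R S)) →L[ℂ] SR (DPIdx P Q R S)).restrictScalars ℝ))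

/-- unfolding `rotBoostGen`. [folklore] -/
theorem rotBoostGen_apply (θ : ℝ) (f : SR (DPIdx P Q R S)) :
    rotBoostGen R S p₀ q₀ θ f = unitaryOpPi (phaseU R S p₀ θ) (hypOpGen R S p₀ q₀ (unitaryOpPi (phaseU R S p₀ θ)⁻¹ f)) :=
  rfl

/-- `rotBoostOp θ 0 = id`. [folklore] -/
theorem rotBoostOp_zero_apply (θ : ℝ) (f : SR (DPIdx P Q R S)) : rotBoostOp R S p₀ q₀ θ 0 f = f := by
  rw [rotBoostOp_apply, hypOp_zero, ContinuousLinearMap.id_apply, unitaryOpPi_mul_inv_apply]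

/-- **THE SLOPE of the conjugated family**: `((t:ℝ):ℂ)⁻¹ • (rotBoostOp θ t f − f) ⟶ rotBoostGen θ f` along `𝓝[≠] 0`
(theta-1's `tendsto_hypOp_sub_div_ofReal` pushed through the continuous linear `μ₀(D_θ)`). [cite: Folland1989, (4.24)] -/
theorem tendsto_rotBoostOp_sub_div_ofReal (θ : ℝ) (f : SR (DPIdx P Q R S)) :
    Tendsto (fun t : ℝ => ((t : ℝ) : ℂ)⁻¹ • (rotBoostOp R S p₀ q₀ θ t f - f)) (𝓝[≠] 0) (𝓝 (rotBoostGen R S p₀ q₀ θ f)) := by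
  have hf : unitaryOpPi (phaseU R S p₀ θ) (unitaryOpPi (phaseU R S p₀ θ)⁻¹ f) = f := unitaryOpPi_mul_inv_apply _ f
  have h := ((unitaryOpPi (phaseU R S p₀ θ)).continuous.tendsto
    (hypOpGen R S p₀ q₀ (unitaryOpPi (phaseU R S p₀ θ)⁻¹ f))).comp
      (tendsto_hypOp_sub_div_ofReal R S p₀ q₀ (unitaryOpPi (phaseU R S p₀ θ)⁻¹ f))
  rw [rotBoostGen_apply]
  refine h.congr fun t => ?_
  simp only [Function.comp_apply, map_smul, map_sub, hf, rotBoostOp_apply]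

/-- the slope with real scalars. [cite: Folland1989, (4.24)] -/
theorem tendsto_rotBoostOp_sub_div (θ : ℝ) (f : SR (DPIdx P Q R S)) :
    Tendsto (fun t : ℝ => t⁻¹ • (rotBoostOp R S p₀ q₀ θ t f - f)) (𝓝[≠] 0) (𝓝 (rotBoostGen R S p₀ q₀ θ f)) :=
  tendsto_ofReal_inv_smul_iff.1 (tendsto_rotBoostOp_sub_div_ofReal R S p₀ q₀ θ f)

/-! ## §4  The Fock matrix of `rotBoostGen θ` -/

/-- **THE FOCK MATRIX OF THE CONJUGATED GENERATOR**: with `z = e^{iθ}`,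
`rotBoostGen θ (B⁻¹F) = B⁻¹ ( i ( Σ_s (π z̄ · zz' + π⁻¹ z · ∂∂') F − Σ_r (π z · zz' + π⁻¹ z̄ · ∂∂') F ) )` — per plane the pair
symbol of `hypOpGen_binvPi_frame` re-weighted by the phases of `D_θ`. [cite: Folland1989, Prop (4.39)] -/
theorem rotBoostGen_binvPi (θ : ℝ) (F : MvPolynomial (DPIdx P Q R S) ℂ) :
    rotBoostGen R S p₀ q₀ θ (binvPi F) =
      binvPi (I • ((∑ s : S, pairSymbW ((π : ℂ) * star ((Circle.exp θ : Circle) : ℂ))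
          ((π : ℂ)⁻¹ * ((Circle.exp θ : Circle) : ℂ)) (Sum.inr (Sum.inl (p₀, s))) (Sum.inl (Sum.inr (q₀, s))) F) -
        ∑ r : R, pairSymbW ((π : ℂ) * ((Circle.exp θ : Circle) : ℂ))
          ((π : ℂ)⁻¹ * star ((Circle.exp θ : Circle) : ℂ)) (Sum.inl (Sum.inl (p₀, r))) (Sum.inr (Sum.inr (q₀, r))) F)) := by
  rw [rotBoostGen_apply, unitaryOpPi_binvPi, star_coe_inv_unitary, hypOpGen_binvPi_frame, unitaryOpPi_binvPi, coe_phaseU,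
    Matrix.star_eq_conjTranspose, Matrix.diagonal_conjTranspose]
  congr 1
  simp only [map_smul, map_sub, map_sum, hypPairSymb_eq_pairSymbW,
    linSubst_diagonal_star_pairSymbW _ (phaseWt_mul_star R S p₀ θ), phaseWt_PR, phaseWt_QR, phaseWt_PS, phaseWt_QS,
    star_star, star_one, mul_one]

/-! ## §5  The `𝔭^∓` combinations at `θ = π/2` and what they kill -/

omit [Fintype P] [Fintype Q] [Fintype R] [Fintype S] [DecidableEq Q] [DecidableEq R] [DecidableEq S] in
/-- per `S`-plane: `i·(π zz' + π⁻¹∂∂') + i·i·(−iπ zz' + iπ⁻¹ ∂∂') = 2πi · zz'` (creation). [folklore] -/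
theorem pairSymbW_pMinus_S {σ : Type*} (k k' : σ) (F : MvPolynomial σ ℂ) :
    I • pairSymbW (π : ℂ) (π : ℂ)⁻¹ k k' F + I • (I • pairSymbW ((π : ℂ) * star I) ((π : ℂ)⁻¹ * I) k k' F) =
      (2 * π * I : ℂ) • (X k * (X k' * F)) := by
  have hI : I * I = -1 := Complex.I_mul_I
  simp only [pairSymbW, Complex.star_def, Complex.conj_I, smul_add, smul_smul]
  match_scalars <;> first | linear_combination (-(I * (π : ℂ))) * hI | linear_combination (I * (π : ℂ)⁻¹) * hI

omit [Fintype P] [Fintype Q] [Fintype R] [Fintype S] [DecidableEq Q] [DecidableEq R] [DecidableEq S] in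
/-- per `R`-plane: `i·(π zz' + π⁻¹∂∂') + i·i·(iπ zz' − iπ⁻¹ ∂∂') = (2i/π) · ∂∂'` (annihilation). [folklore] -/
theorem pairSymbW_pMinus_R {σ : Type*} (k k' : σ) (F : MvPolynomial σ ℂ) :
    I • pairSymbW (π : ℂ) (π : ℂ)⁻¹ k k' F + I • (I • pairSymbW ((π : ℂ) * I) ((π : ℂ)⁻¹ * star I) k k' F) =
      (2 * (π : ℂ)⁻¹ * I : ℂ) • pderiv k (pderiv k' F) := by
  have hI : I * I = -1 := Complex.I_mul_I
  simp only [pairSymbW, Complex.star_def, Complex.conj_I, smul_add, smul_smul]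
  match_scalars <;> first | linear_combination (I * (π : ℂ)) * hI | linear_combination (-(I * (π : ℂ)⁻¹)) * hI

omit [Fintype P] [Fintype Q] [Fintype R] [Fintype S] [DecidableEq Q] [DecidableEq R] [DecidableEq S] in
/-- per `S`-plane, conjugate combination: `i·(…) − i·i·(…) = (2i/π) · ∂∂'` (annihilation). [folklore] -/
theorem pairSymbW_pPlus_S {σ : Type*} (k k' : σ) (F : MvPolynomial σ ℂ) :
    I • pairSymbW (π : ℂ) (π : ℂ)⁻¹ k k' F - I • (I • pairSymbW ((π : ℂ) * star I) ((π : ℂ)⁻¹ * I) k k' F) =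
      (2 * (π : ℂ)⁻¹ * I : ℂ) • pderiv k (pderiv k' F) := by
  have hI : I * I = -1 := Complex.I_mul_I
  simp only [pairSymbW, Complex.star_def, Complex.conj_I, smul_add, smul_smul]
  match_scalars <;> first | linear_combination (I * (π : ℂ)) * hI | linear_combination (-(I * (π : ℂ)⁻¹)) * hI

omit [Fintype P] [Fintype Q] [Fintype R] [Fintype S] [DecidableEq Q] [DecidableEq R] [DecidableEq S] in
/-- per `R`-plane, conjugate combination: `i·(…) − i·i·(…) = 2πi · zz'` (creation). [folklore] -/
theorem pairSymbW_pPlus_R {σ : Type*} (k k' : σ) (F : MvPolynomial σ ℂ) :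
    I • pairSymbW (π : ℂ) (π : ℂ)⁻¹ k k' F - I • (I • pairSymbW ((π : ℂ) * I) ((π : ℂ)⁻¹ * star I) k k' F) =
      (2 * π * I : ℂ) • (X k * (X k' * F)) := by
  have hI : I * I = -1 := Complex.I_mul_I
  simp only [pairSymbW, Complex.star_def, Complex.conj_I, smul_add, smul_smul]
  match_scalars <;> first | linear_combination (-(I * (π : ℂ))) * hI | linear_combination (I * (π : ℂ)⁻¹) * hI

/-- **THE FOCK SYMBOL OF `𝔭⁻`** (`X_v + iX_{iv}`, LOWER-LEFT block, `v = −i e_{p₀}` the direction of `hyp`):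
`hypOpGen (B⁻¹F) + i · rotBoostGen (π/2) (B⁻¹F) = B⁻¹ ( 2πi Σ_s z_{(p₀,s)} z_{(q₀,s)} F − (2i/π) Σ_r ∂_{(p₀,r)} ∂_{(q₀,r)} F )`
— creation on the `S`-planes, annihilation on the `R`-planes. [cite: Folland1989, Prop (4.39)] -/
theorem hypOpGen_add_I_smul_rotBoostGen_binvPi (F : MvPolynomial (DPIdx P Q R S) ℂ) :
    hypOpGen R S p₀ q₀ (binvPi F) + I • rotBoostGen R S p₀ q₀ (π / 2) (binvPi F) =
      binvPi ((2 * π * I : ℂ) • ∑ s : S, X (Sum.inr (Sum.inl (p₀, s))) * (X (Sum.inl (Sum.inr (q₀, s))) * F) -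
        (2 * (π : ℂ)⁻¹ * I : ℂ) • ∑ r : R, pderiv (Sum.inl (Sum.inl (p₀, r))) (pderiv (Sum.inr (Sum.inr (q₀, r))) F)) := by
  rw [hypOpGen_binvPi_frame, rotBoostGen_binvPi, coe_circleExp_pi_div_two, ← binvPi_smul, ← binvPi_add]
  congr 1
  simp only [hypPairSymb_eq_pairSymbW, smul_sub, Finset.smul_sum]
  rw [show ∀ a b c d : MvPolynomial (DPIdx P Q R S) ℂ, a - b + (c - d) = (a + c) - (b + d) from fun a b c d => by abel,
    ← Finset.sum_add_distrib, ← Finset.sum_add_distrib]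
  simp only [pairSymbW_pMinus_S, pairSymbW_pMinus_R]

/-- **THE FOCK SYMBOL OF `𝔭⁺`** (`X_v − iX_{iv}`, UPPER-RIGHT block):
`hypOpGen (B⁻¹F) − i · rotBoostGen (π/2) (B⁻¹F) = B⁻¹ ( (2i/π) Σ_s ∂_{(p₀,s)} ∂_{(q₀,s)} F − 2πi Σ_r z_{(p₀,r)} z_{(q₀,r)} F )`
— annihilation on the `S`-planes, creation on the `R`-planes. [cite: Folland1989, Prop (4.39)] -/
theorem hypOpGen_sub_I_smul_rotBoostGen_binvPi (F : MvPolynomial (DPIdx P Q R S) ℂ) :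
    hypOpGen R S p₀ q₀ (binvPi F) - I • rotBoostGen R S p₀ q₀ (π / 2) (binvPi F) =
      binvPi ((2 * (π : ℂ)⁻¹ * I : ℂ) • ∑ s : S, pderiv (Sum.inr (Sum.inl (p₀, s))) (pderiv (Sum.inl (Sum.inr (q₀, s))) F) -
        (2 * π * I : ℂ) • ∑ r : R, X (Sum.inl (Sum.inl (p₀, r))) * (X (Sum.inr (Sum.inr (q₀, r))) * F)) := by
  rw [hypOpGen_binvPi_frame, rotBoostGen_binvPi, coe_circleExp_pi_div_two, ← binvPi_smul, ← binvPi_sub]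
  congr 1
  simp only [hypPairSymb_eq_pairSymbW, smul_sub, Finset.smul_sum]
  rw [show ∀ a b c d : MvPolynomial (DPIdx P Q R S) ℂ, a - b - (c - d) = (a - c) - (b - d) from fun a b c d => by abel,
    ← Finset.sum_sub_distrib, ← Finset.sum_sub_distrib]
  simp only [pairSymbW_pPlus_S, pairSymbW_pPlus_R]

/-- **`𝔭⁻` KILLS, second member compact (`S = ∅`)**: for `F` with `∂_{(p₀,r)} ∂_{(q₀,r)} F = 0` for all `r`,
`hypOpGen (B⁻¹F) + i · rotBoostGen (π/2) (B⁻¹F) = 0`. [cite: Folland1989, Prop (4.39)] -/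
theorem hypOpGen_add_I_smul_rotBoostGen_binvPi_eq_zero [IsEmpty S] (F : MvPolynomial (DPIdx P Q R S) ℂ)
    (hF : ∀ r : R, pderiv (Sum.inl (Sum.inl (p₀, r))) (pderiv (Sum.inr (Sum.inr (q₀, r))) F) = 0) :
    hypOpGen R S p₀ q₀ (binvPi F) + I • rotBoostGen R S p₀ q₀ (π / 2) (binvPi F) = 0 := by
  rw [hypOpGen_add_I_smul_rotBoostGen_binvPi]
  simp only [Finset.univ_eq_empty, Finset.sum_empty, smul_zero, hF, Finset.sum_const_zero, sub_zero, binvPi_zero]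

/-- **`𝔭⁺` KILLS, first plane type absent (`R = ∅`)** — the mirror statement. [cite: Folland1989, Prop (4.39)] -/
theorem hypOpGen_sub_I_smul_rotBoostGen_binvPi_eq_zero [IsEmpty R] (F : MvPolynomial (DPIdx P Q R S) ℂ)
    (hF : ∀ s : S, pderiv (Sum.inr (Sum.inl (p₀, s))) (pderiv (Sum.inl (Sum.inr (q₀, s))) F) = 0) :
    hypOpGen R S p₀ q₀ (binvPi F) - I • rotBoostGen R S p₀ q₀ (π / 2) (binvPi F) = 0 := by
  rw [hypOpGen_sub_I_smul_rotBoostGen_binvPi]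
  simp only [Finset.univ_eq_empty, Finset.sum_empty, smul_zero, hF, Finset.sum_const_zero, zero_sub, neg_zero,
    binvPi_zero]

/-- **`𝔭⁻` kills the vacuum** `h_0 = B⁻¹ ζ_0` (`S = ∅`). [cite: Folland1989, Prop (4.39)] -/
theorem hypOpGen_add_I_smul_rotBoostGen_hermitePi_zero [IsEmpty S] :
    hypOpGen R S p₀ q₀ (hermitePi 0 : SR (DPIdx P Q R S)) + I • rotBoostGen R S p₀ q₀ (π / 2) (hermitePi 0) = 0 := by
  rw [← binvPi_zeta]
  exact hypOpGen_add_I_smul_rotBoostGen_binvPi_eq_zero R S p₀ q₀ _ fun r => pderiv_pderiv_zeta_zero _ _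

/-- **`𝔭⁻` kills every degree-one vector** `degOne a = Σ a_i h_{e_i}` (all four blocks; `S = ∅`).
[cite: Folland1989, Prop (4.39)] -/
theorem hypOpGen_add_I_smul_rotBoostGen_degOne [IsEmpty S] (a : DPIdx P Q R S → ℂ) :
    hypOpGen R S p₀ q₀ (degOne a : SR (DPIdx P Q R S)) + I • rotBoostGen R S p₀ q₀ (π / 2) (degOne a) = 0 := by
  have h : (degOne a : SR (DPIdx P Q R S)) = binvPi (∑ j, a j • zeta (Finsupp.single j 1)) := by
    rw [binvPi_sum_smul_zeta_single]; rfl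
  rw [h]
  exact hypOpGen_add_I_smul_rotBoostGen_binvPi_eq_zero R S p₀ q₀ _ fun r => pderiv_pderiv_sum_smul_zeta_single _ _ _ _

/-- on the vacuum with `R = ∅` the SAME combination is pure creation:
`hypOpGen h_0 + i · rotBoostGen (π/2) h_0 = B⁻¹ (2πi Σ_s z_{(p₀,s)} z_{(q₀,s)} ζ_0)` — the orientation flips with the sign of
the second member. [cite: Folland1989, Prop (4.39)] -/
theorem hypOpGen_add_I_smul_rotBoostGen_hermitePi_zero_of_isEmpty_R [IsEmpty R] :
    hypOpGen R S p₀ q₀ (hermitePi 0 : SR (DPIdx P Q R S)) + I • rotBoostGen R S p₀ q₀ (π / 2) (hermitePi 0) =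
      binvPi ((2 * π * I : ℂ) • ∑ s : S, X (Sum.inr (Sum.inl (p₀, s))) * (X (Sum.inl (Sum.inr (q₀, s))) *
        zeta (0 : DPIdx P Q R S →₀ ℕ))) := by
  rw [← binvPi_zeta, hypOpGen_add_I_smul_rotBoostGen_binvPi]
  simp only [Finset.univ_eq_empty, Finset.sum_empty, smul_zero, sub_zero]

end Rot


end RealDualPair

end Literature.RepresentationTheory.KonnoKonno2007

end
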